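import Literature.MathematicalPhysics.KineticTheory.CollisionTubePullbackFlight
import HarnessLib

/-!
# Short gaps between two collisions of one hard sphere: aiming at the previous birth (pathwise)

Topic `Literature/MathematicalPhysics/KineticTheory` (wanted by the crux line `plaque-thinning-count-ld` of
`CollisionActivityTails`, stmt-AtomisticToContinuum-13734, stub `OwnBirthThinning`: the own-birth thinning of the
collision count of one sphere; companion of `ShortFlightCharging.lean`, which charges short flights of a PAIR).

Along a good hard-sphere orbit on `𝕋³` (`N + 1` spheres of diameter `ε = hsDiameter σ N`) consider two CONSECUTIVE
collision times `s < e` of sphere `i` with `e − s ≤ δ` (a short gap), the partner `q` of `i` at `e`, and the start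
`b ∈ [s, e)` of the flight of `q` current at `e` (`flightStart` from `s`). The file proves the deterministic kinematics and
bookkeeping of "own-birth thinning" — every short gap is an aimed birth or an abnormal event:

* §1 algebra: from a later contact `‖d − g v‖ = ε < ‖d‖`, `g > 0`, the ray along `v` aims at `d` within `2ε`
  (`aim_of_contact`: `⟪d, v⟫ > 0` and `‖d‖²‖v‖² − ⟪d,v⟫² ≤ (2ε)²‖v‖²`, Lagrange's identity); the energy exit
  `le_of_sq_add_sq_eq` (`‖v_i⁻‖² + ‖v_q⁻‖² = ‖v_i⁺‖² + ‖v_q⁺‖²`).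
* §2 finite combinatorics on `ℝ`: `card_le_thinning` (`#F ≤ 1 + w/δ + #{short gaps}` for a finite `F ⊂ (0, w]`: the long
  gaps start at points pairwise `≥ δ` apart, `s ↦ ⌊s/δ⌋₊` injects them into `range ⌊w/δ⌋₊`), and counting by an injective
  charge (`card_le_sum_of_injOn`, `injOn_of_lt`).
* §3 kinematics of one gap: an outgoing pair does not re-collide within a short free flight
  (`not_mem_contactPairs_of_contact_later`); backward from the contact at `e` the minimal image follows the pair free
  flight (`sepAt_orbit_eq`, `ε + 2uδ < 1/2`), so that at `b` the SHOOTER (`i` if `b = s`, else `q`, born at `b`) is aimed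
  at the other sphere of `{i, q}` within the catch radius `ε + 2uδ` (`slow_gap_geometry`, `slow_gap`) — unless a
  post-collisional speed at `e` exceeds `u/2` (then a pre-collisional one exceeded `u/√2`).
* §4 counting: the collision sum of `𝟙[fst = i]` is the number of collision times of `i` (`collisionSum_ite_fst_eq_card`,
  binary collisions), and the CHARGING THEOREM `card_shortGaps_le_sums`: a family of short gaps of `i` with pairwise
  disjoint spans is charged injectively to unit summands of two finite sums with abstract nonnegative weights — births
  `(shooter, b)` that are "normal" (an arbitrary predicate) and aimed, and records `(b, (shooter, partner))` (abnormal
  birth) or `(e, (q, i))` (fast end; distinct from the record `(i, ·)` that a gap STARTING at `e` may charge).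

This is the pathwise half of the control of short free flights by aimed births (Cercignani–Illner–Pulvirenti 1994
§2.2 and App. 4.A: a collision preceded within a short time by a collision of a partner is a three-body contact event;
Gallagher–Saint-Raymond–Texier 2013 §4.1, Prop. 4.1.1: free flow between collisions, elastic reflection, binary
collisions a.e.). Deliberately NOT here: any probability (the static / dynamical prices of the two sums are route items).

## References

* C. Cercignani, R. Illner, M. Pulvirenti, *The Mathematical Theory of Dilute Gases* (1994), §2.2, App. 4.A.
  [CIPDiluteGases1994]
* I. Gallagher, L. Saint-Raymond, B. Texier, *From Newton to Boltzmann* (2013), Part II Ch. 4, §4.1, Prop. 4.1.1,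
  Def. 4.1.2.  [GallagherSaintRaymondTexier2013]
-/

noncomputable section

open scoped BigOperators Classical InnerProductSpace Topology
open Set Filter Function
open Literature.Analysis.FluidPDE Literature.Analysis.FunctionSpaces

namespace Literature.MathematicalPhysics.KineticTheory

/-! ## §1 Algebra: aiming from a later contact, energy exit -/

/-- **Aiming from a later contact.** If `‖d − g • v‖ = e` for some `g > 0` while `e < ‖d‖` (`e ≥ 0`), then the forward
ray along `v` from the origin passes within `2e` of `d`: `⟪d, v⟫ > 0` and `‖d‖²‖v‖² − ⟪d,v⟫² ≤ (2e)²‖v‖²` (expansion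
of `‖d − gv‖²` and Lagrange's identity `‖v‖²‖d − gv‖² − (‖d‖²‖v‖² − ⟪d,v⟫²) = (⟪d,v⟫ − g‖v‖²)²`). [folklore] -/
theorem aim_of_contact {d v : V3} {g e : ℝ} (hg : 0 < g) (he : 0 ≤ e) (hcontact : ‖d - g • v‖ = e)
    (hfar : e < ‖d‖) :
    0 < ⟪d, v⟫_ℝ ∧ ‖d‖ ^ 2 * ‖v‖ ^ 2 - ⟪d, v⟫_ℝ ^ 2 ≤ (2 * e) ^ 2 * ‖v‖ ^ 2 := by
  have hexp : ‖d - g • v‖ ^ 2 = ‖d‖ ^ 2 - 2 * g * ⟪d, v⟫_ℝ + g ^ 2 * ‖v‖ ^ 2 := by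
    rw [norm_sub_sq_real, inner_smul_right, norm_smul, mul_pow, Real.norm_eq_abs, sq_abs]; ring
  have hlt : e ^ 2 < ‖d‖ ^ 2 := by nlinarith [norm_nonneg d]
  refine ⟨?_, ?_⟩
  · by_contra hle
    have hle' : ⟪d, v⟫_ℝ ≤ 0 := not_lt.1 hle
    have h2 : e ^ 2 < ‖d - g • v‖ ^ 2 := by
      rw [hexp]
      nlinarith [mul_nonneg hg.le (neg_nonneg.2 hle'), sq_nonneg (g * ‖v‖)]
    rw [hcontact] at h2
    exact lt_irrefl _ h2
  · have key : ‖v‖ ^ 2 * ‖d - g • v‖ ^ 2 - (‖d‖ ^ 2 * ‖v‖ ^ 2 - ⟪d, v⟫_ℝ ^ 2) =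
        (⟪d, v⟫_ℝ - g * ‖v‖ ^ 2) ^ 2 := by
      rw [hexp]; ring
    rw [hcontact] at key
    nlinarith [sq_nonneg (⟪d, v⟫_ℝ - g * ‖v‖ ^ 2), mul_nonneg (sq_nonneg e) (sq_nonneg ‖v‖)]

/-- **Energy exit.** If `a² + b² = c² + d²` with `c, d ≤ u/2` (`c, d ≥ 0`, `u > 0`), then `a ≤ u` and `b ≤ u` (indeed
`≤ u/√2`): at an elastic collision, if both outgoing speeds are `≤ u/2` then both incoming speeds were `≤ u`. [folklore] -/
theorem le_of_sq_add_sq_eq {a b c d u : ℝ} (hu : 0 < u) (hc : 0 ≤ c) (hd : 0 ≤ d)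
    (hE : a ^ 2 + b ^ 2 = c ^ 2 + d ^ 2) (hcu : c ≤ u / 2) (hdu : d ≤ u / 2) : a ≤ u ∧ b ≤ u := by
  have hc2 : c ^ 2 ≤ (u / 2) ^ 2 := pow_le_pow_left₀ hc hcu 2
  have hd2 : d ^ 2 ≤ (u / 2) ^ 2 := pow_le_pow_left₀ hd hdu 2
  constructor
  · by_contra h
    have h' : u < a := not_le.1 h
    nlinarith [mul_lt_mul' h'.le h' hu.le (hu.trans h'), sq_nonneg b]
  · by_contra h
    have h' : u < b := not_le.1 h
    nlinarith [mul_lt_mul' h'.le h' hu.le (hu.trans h'), sq_nonneg a]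

/-! ## §2 Finite combinatorics of gaps -/

/-- **Thinning of a finite set of times by a gap scale.** Let `F ⊂ (0, w]` be finite and nonempty and let `nx` send
every non-maximal `s ∈ F` to a later point of `F` below every element of `F` after `s` (the next element). Then
`#F ≤ 1 + w/δ + #{s ∈ F ∖ {max F} : nx s − s < δ}`: the other non-maximal elements (long gaps, `nx s ≥ s + δ`) are
pairwise `≥ δ` apart in `(0, w − δ]`, so `s ↦ ⌊s/δ⌋₊` injects them into `range ⌊w/δ⌋₊`. [folklore] -/
theorem card_le_thinning (F : Finset ℝ) (hF : F.Nonempty) (nx : ℝ → ℝ) {w δ : ℝ} (hδ : 0 < δ) (hw : 0 ≤ w)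
    (hmem : ∀ s ∈ F, 0 < s ∧ s ≤ w)
    (hnx : ∀ s ∈ F, s ≠ F.max' hF → s < nx s ∧ ∀ s' ∈ F, s < s' → nx s ≤ s') :
    (F.card : ℝ) ≤ 1 + w / δ + (((F.erase (F.max' hF)).filter fun s => nx s - s < δ).card : ℝ) := by
  set M := F.max' hF with hM
  set F' := F.erase M with hF'
  have hcard : F.card = F'.card + 1 := (Finset.card_erase_add_one (F.max'_mem hF)).symm
  have hsplit := Finset.card_filter_add_card_filter_not (s := F') (fun s => nx s - s < δ)
  have hF'mem : ∀ s ∈ F', s ∈ F ∧ s ≠ M := fun s hs =>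
    ⟨Finset.mem_of_mem_erase hs, Finset.ne_of_mem_erase hs⟩
  have hnxw : ∀ s ∈ F', nx s ≤ w := by
    intro s hs
    obtain ⟨hsF, hsM⟩ := hF'mem s hs
    have hlt : s < M := Finset.lt_max'_of_mem_erase_max' F hF hs
    exact ((hnx s hsF hsM).2 M (F.max'_mem hF) hlt).trans (hmem M (F.max'_mem hF)).2
  -- the long gaps
  have hLG : (((F'.filter fun s => ¬ nx s - s < δ).card : ℕ) : ℝ) ≤ w / δ := by
    have h1 : (F'.filter fun s => ¬ nx s - s < δ).card ≤ (Finset.range ⌊w / δ⌋₊).card := by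
      refine Finset.card_le_card_of_injOn (fun s => ⌊s / δ⌋₊) ?_ ?_
      · intro s hs
        rw [Finset.coe_filter] at hs
        obtain ⟨hsF', hlong⟩ := hs
        have hsδ : s / δ + 1 ≤ w / δ := by
          rw [div_add_one hδ.ne', div_le_div_iff_of_pos_right hδ]
          linarith [hnxw s hsF', not_lt.1 hlong]
        have hs0 : 0 ≤ s / δ := div_nonneg (hmem s (hF'mem s hsF').1).1.le hδ.le
        rw [Finset.coe_range, Set.mem_Iio, ← Nat.add_one_le_iff, ← Nat.floor_add_one hs0]
        exact Nat.floor_le_floor hsδ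
      · have key : ∀ s ∈ (F'.filter fun s => ¬ nx s - s < δ), ∀ s' ∈ (F'.filter fun s => ¬ nx s - s < δ),
            s < s' → ⌊s / δ⌋₊ < ⌊s' / δ⌋₊ := by
          intro s hs s' hs' hlt
          rw [Finset.mem_filter] at hs hs'
          have hss' : nx s ≤ s' :=
            (hnx s (hF'mem s hs.1).1 (hF'mem s hs.1).2).2 s' (hF'mem s' hs'.1).1 hlt
          have hsδ : s / δ + 1 ≤ s' / δ := by
            rw [div_add_one hδ.ne', div_le_div_iff_of_pos_right hδ]
            linarith [not_lt.1 hs.2]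
          have hs0 : 0 ≤ s / δ := div_nonneg (hmem s (hF'mem s hs.1).1).1.le hδ.le
          rw [← Nat.add_one_le_iff, ← Nat.floor_add_one hs0]
          exact Nat.floor_le_floor hsδ
        intro s hs s' hs' heq
        rcases lt_trichotomy s s' with h | h | h
        · exact absurd heq (key s hs s' hs' h).ne
        · exact h
        · exact absurd heq (key s' hs' s hs h).ne'
    calc (((F'.filter fun s => ¬ nx s - s < δ).card : ℕ) : ℝ) ≤ ((Finset.range ⌊w / δ⌋₊).card : ℝ) := by
          exact_mod_cast h1
      _ = ⌊w / δ⌋₊ := by rw [Finset.card_range]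
      _ ≤ w / δ := Nat.floor_le (div_nonneg hw hδ.le)
  have hcardR : (F.card : ℝ) = ((F'.filter fun s => nx s - s < δ).card : ℝ) +
      ((F'.filter fun s => ¬ nx s - s < δ).card : ℝ) + 1 := by
    rw [hcard, ← hsplit]; push_cast; ring
  rw [hcardR]
  linarith

/-- **Counting by an injective charge.** If `φ` maps `A` injectively into `D` and the nonnegative weight `g` equals `1`
on the image, then `#A ≤ ∑_{x ∈ D} g x`. [folklore] -/
theorem card_le_sum_of_injOn {α β : Type*} (A : Finset α) (D : Finset β) (g : β → ℝ)
    (φ : α → β) (hg : ∀ x ∈ D, 0 ≤ g x) (hmaps : ∀ a ∈ A, φ a ∈ D) (hinj : Set.InjOn φ A)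
    (hone : ∀ a ∈ A, g (φ a) = 1) : (A.card : ℝ) ≤ ∑ x ∈ D, g x := by
  have himg : A.image φ ⊆ D := fun x hx => by
    obtain ⟨a, ha, rfl⟩ := Finset.mem_image.1 hx
    exact hmaps a ha
  calc (A.card : ℝ) = ((A.image φ).card : ℝ) := by rw [Finset.card_image_of_injOn hinj]
    _ = ∑ x ∈ A.image φ, (1 : ℝ) := by simp
    _ = ∑ x ∈ A.image φ, g x := by
        refine Finset.sum_congr rfl fun x hx => ?_
        obtain ⟨a, ha, rfl⟩ := Finset.mem_image.1 hx
        rw [hone a ha]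
    _ ≤ ∑ x ∈ D, g x := Finset.sum_le_sum_of_subset_of_nonneg himg fun x hx _ => hg x hx

/-- Injectivity of a map on a finite set of reals from the ordered case `s₁ < s₂`. [folklore] -/
theorem injOn_of_lt {β : Type*} {A : Finset ℝ} {φ : ℝ → β}
    (h : ∀ s₁ ∈ A, ∀ s₂ ∈ A, s₁ < s₂ → φ s₁ ≠ φ s₂) : Set.InjOn φ A := by
  intro s₁ hs₁ s₂ hs₂ heq
  rcases lt_trichotomy s₁ s₂ with hlt | rfl | hgt
  · exact absurd heq (h s₁ hs₁ s₂ hs₂ hlt)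
  · rfl
  · exact absurd heq.symm (h s₂ hs₂ s₁ hs₁ hgt)

/-! ## §3 Kinematics of one gap along a good orbit -/

section Orbit

variable {σ : ℝ} {N : ℕ} {Φ : HardSphereFlow (Torus.geometry (Fin 3)) (hsDiameter σ N) (N + 1)}
  {z : Config (N + 1) (Fin 3) T3}

/-- **Outgoing pairs do not re-collide within a short free flight.** If `i` and `q` both fly freely on `(b, e)`, are
at contact at `e`, and `ε + (e − b)‖v_i(b) − v_q(b)‖ < 1/2` (the minimal image follows the pair free flight), then they
were NOT at contact at `b`: an outgoing pair separates, `‖q₀ + t w‖² = ε² + 2t⟪q₀, w⟫ + t²‖w‖² > ε²`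
(cf. `one_le_relSpeed_div_of_recollision`). [folklore] -/
theorem not_mem_contactPairs_of_contact_later (hz : z ∈ Φ.good) {i q : Fin (N + 1)} {b e : ℝ} (hbe : b < e)
    (hif : ∀ t ∈ Ioo b e, ¬ Participates (Torus.geometry (Fin 3)) (hsDiameter σ N) (orbit σ N Φ z t) i)
    (hqf : ∀ t ∈ Ioo b e, ¬ Participates (Torus.geometry (Fin 3)) (hsDiameter σ N) (orbit σ N Φ z t) q)
    (hsmall : hsDiameter σ N + (e - b) * ‖relVel (orbit σ N Φ z b) i q‖ < 2⁻¹)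
    (hce : (i, q) ∈ contactPairs (Torus.geometry (Fin 3)) (hsDiameter σ N) (orbit σ N Φ z e)) :
    (i, q) ∉ contactPairs (Torus.geometry (Fin 3)) (hsDiameter σ N) (orbit σ N Φ z b) := by
  intro hcb
  have hγ := isTraj hz
  have hq0 : ‖sepAt (orbit σ N Φ z b) i q‖ = hsDiameter σ N :=
    ((mem_contactPairs_iff_of_mem (orbit_mem hz b)).1 hcb).2
  have hqe : ‖sepAt (orbit σ N Φ z e) i q‖ = hsDiameter σ N :=
    ((mem_contactPairs_iff_of_mem (orbit_mem hz e)).1 hce).2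
  have hout : 0 < ⟪sepAt (orbit σ N Φ z b) i q, relVel (orbit σ N Φ z b) i q⟫_ℝ :=
    hγ.inner_sepVec_postVel_pos hcb
  have hlt : ‖sepAt (orbit σ N Φ z b) i q + (e - b) • relVel (orbit σ N Φ z b) i q‖ < 1 / 2 := by
    calc ‖sepAt (orbit σ N Φ z b) i q + (e - b) • relVel (orbit σ N Φ z b) i q‖
        ≤ ‖sepAt (orbit σ N Φ z b) i q‖ + ‖(e - b) • relVel (orbit σ N Φ z b) i q‖ := norm_add_le _ _
      _ = hsDiameter σ N + (e - b) * ‖relVel (orbit σ N Φ z b) i q‖ := by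
          rw [hq0, norm_smul, Real.norm_eq_abs, abs_of_pos (sub_pos.2 hbe)]
      _ < 1 / 2 := by rw [one_div]; exact hsmall
  have heq := sepAt_orbit_eq hz hbe.le hif hqf ⟨le_rfl, hbe.le⟩ ⟨hbe.le, le_rfl⟩ hlt
  have hexp : ‖sepAt (orbit σ N Φ z b) i q + (e - b) • relVel (orbit σ N Φ z b) i q‖ ^ 2 =
      ‖sepAt (orbit σ N Φ z b) i q‖ ^ 2 +
        2 * (e - b) * ⟪sepAt (orbit σ N Φ z b) i q, relVel (orbit σ N Φ z b) i q⟫_ℝ +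
        (e - b) ^ 2 * ‖relVel (orbit σ N Φ z b) i q‖ ^ 2 := by
    rw [norm_add_sq_real, inner_smul_right, norm_smul, mul_pow, Real.norm_eq_abs, sq_abs]; ring
  have h2 : hsDiameter σ N ^ 2 < ‖sepAt (orbit σ N Φ z e) i q‖ ^ 2 := by
    rw [heq, hexp, hq0]
    nlinarith [mul_pos (sub_pos.2 hbe) hout, sq_nonneg ((e - b) * ‖relVel (orbit σ N Φ z b) i q‖)]
  rw [hqe] at h2
  exact lt_irrefl _ h2

/-- **Geometry of a slow gap, backward from the contact.** Shooter `S` and target `T` fly freely on `(b, e)`, the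
ordered pair `(T, S)` is at contact at `e`, `T` takes part in no collision at `b`, and
`ε + (e − b)‖v_T(b) − v_S(b)‖ < 1/2`. Then at time `b` the minimal-image separation `d = x_T − x_S` satisfies
`ε < ‖d‖ ≤ ε + (e − b)‖v_T − v_S‖`, and the relative velocity `v = v_S − v_T` of the shooter aims at `d` within `2ε`:
`⟪d, v⟫ > 0`, `‖d‖²‖v‖² − ⟪d,v⟫² ≤ (2ε)²‖v‖²`. [folklore] -/
theorem slow_gap_geometry (hz : z ∈ Φ.good) (hε : 0 ≤ hsDiameter σ N) {S T : Fin (N + 1)} {b e : ℝ}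
    (hbe : b < e)
    (hSf : ∀ t ∈ Ioo b e, ¬ Participates (Torus.geometry (Fin 3)) (hsDiameter σ N) (orbit σ N Φ z t) S)
    (hTf : ∀ t ∈ Ioo b e, ¬ Participates (Torus.geometry (Fin 3)) (hsDiameter σ N) (orbit σ N Φ z t) T)
    (hTb : ¬ Participates (Torus.geometry (Fin 3)) (hsDiameter σ N) (orbit σ N Φ z b) T)
    (hc : (T, S) ∈ contactPairs (Torus.geometry (Fin 3)) (hsDiameter σ N) (orbit σ N Φ z e))
    (hsmall : hsDiameter σ N + (e - b) * ‖relVel (orbit σ N Φ z b) T S‖ < 2⁻¹) :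
    hsDiameter σ N < ‖sepAt (orbit σ N Φ z b) T S‖ ∧
      ‖sepAt (orbit σ N Φ z b) T S‖ ≤ hsDiameter σ N + (e - b) * ‖relVel (orbit σ N Φ z b) T S‖ ∧
      (0 < ⟪sepAt (orbit σ N Φ z b) T S, relVel (orbit σ N Φ z b) S T⟫_ℝ ∧
        ‖sepAt (orbit σ N Φ z b) T S‖ ^ 2 * ‖relVel (orbit σ N Φ z b) S T‖ ^ 2 -
            ⟪sepAt (orbit σ N Φ z b) T S, relVel (orbit σ N Φ z b) S T⟫_ℝ ^ 2 ≤
          (2 * hsDiameter σ N) ^ 2 * ‖relVel (orbit σ N Φ z b) S T‖ ^ 2) := by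
  have hTS : T ≠ S := (mem_contactPairs.1 hc).1
  have hqe : ‖sepAt (orbit σ N Φ z e) T S‖ = hsDiameter σ N :=
    ((mem_contactPairs_iff_of_mem (orbit_mem hz e)).1 hc).2
  have hlt : ‖sepAt (orbit σ N Φ z e) T S + (b - e) • relVel (orbit σ N Φ z b) T S‖ < 1 / 2 := by
    calc ‖sepAt (orbit σ N Φ z e) T S + (b - e) • relVel (orbit σ N Φ z b) T S‖
        ≤ ‖sepAt (orbit σ N Φ z e) T S‖ + ‖(b - e) • relVel (orbit σ N Φ z b) T S‖ := norm_add_le _ _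
      _ = hsDiameter σ N + (e - b) * ‖relVel (orbit σ N Φ z b) T S‖ := by
          rw [hqe, norm_smul, Real.norm_eq_abs, abs_sub_comm, abs_of_pos (sub_pos.2 hbe)]
      _ < 1 / 2 := by rw [one_div]; exact hsmall
  have heq := sepAt_orbit_eq hz hbe.le hTf hSf ⟨hbe.le, le_rfl⟩ ⟨le_rfl, hbe.le⟩ hlt
  have hrel : relVel (orbit σ N Φ z b) S T = -relVel (orbit σ N Φ z b) T S := by
    simp only [relVel, neg_sub]
  have hD : sepAt (orbit σ N Φ z b) T S - (e - b) • relVel (orbit σ N Φ z b) S T =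
      sepAt (orbit σ N Φ z e) T S := by
    rw [heq, hrel, smul_neg, sub_neg_eq_add, add_assoc, ← add_smul]
    have h0 : b - e + (e - b) = 0 := by ring
    rw [h0, zero_smul, add_zero]
  have hne : ‖sepAt (orbit σ N Φ z b) T S‖ ≠ hsDiameter σ N := norm_sepAt_ne_of_not_participates hz hTS hTb
  have hge : hsDiameter σ N ≤ ‖sepAt (orbit σ N Φ z b) T S‖ :=
    (mem_hardSphereDomain.1 (orbit_mem hz b)) T S hTS
  have hfar : hsDiameter σ N < ‖sepAt (orbit σ N Φ z b) T S‖ := lt_of_le_of_ne hge (Ne.symm hne)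
  refine ⟨hfar, ?_, aim_of_contact (sub_pos.2 hbe) hε (by rw [hD, hqe]) hfar⟩
  have hback : sepAt (orbit σ N Φ z b) T S =
      sepAt (orbit σ N Φ z e) T S + (e - b) • relVel (orbit σ N Φ z b) S T := by
    rw [← hD, sub_add_cancel]
  calc ‖sepAt (orbit σ N Φ z b) T S‖
      = ‖sepAt (orbit σ N Φ z e) T S + (e - b) • relVel (orbit σ N Φ z b) S T‖ := by rw [← hback]
    _ ≤ ‖sepAt (orbit σ N Φ z e) T S‖ + ‖(e - b) • relVel (orbit σ N Φ z b) S T‖ := norm_add_le _ _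
    _ = hsDiameter σ N + (e - b) * ‖relVel (orbit σ N Φ z b) T S‖ := by
        rw [hqe, norm_smul, Real.norm_eq_abs, abs_of_pos (sub_pos.2 hbe), hrel, norm_neg]

/-- **The slow gap.** Let `s < e` be consecutive collision times of `i` along a good orbit (`i` flies freely on
`(s, e)`), `e − s ≤ δ`, let `q` be the partner of `i` at `e` and `b` the start of the flight of `q` current at `e`,
counted from `s` (`flightStart`). If both POST-collisional speeds of `i` and `q` at `e` are `≤ u/2` and
`ε + 2uδ < 1/2`, then (energy conservation: the pre-collisional speeds `‖v_i(s)‖, ‖v_q(b)‖` are `≤ u`) `b ∈ [s, e)`,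
the SHOOTER `S` (`i` if `b = s`, `q` if `b > s` — then `i` is mid-flight at `b`) collides at `b`, the TARGET `T` (the
other sphere of `{i, q}`) does not, `T` is neither `S` nor the partner of `S` at `b`, lies within any catch radius
`R ≥ ε + 2uδ` of `S`, has speed `≤ u`, the velocity of `S` relative to `T` aims at `x_T − x_S` within `2ε`, and `S` is
within `R` of `i`. Case `b = s` uses that the outgoing pair at `s` does not re-collide
(`not_mem_contactPairs_of_contact_later`), so `q` is not `i`'s partner at `s`. [folklore] -/
theorem slow_gap (hz : z ∈ Φ.good) {u δ R : ℝ} (hu : 0 < u) (hε : 0 < hsDiameter σ N)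
    (hR : hsDiameter σ N + 2 * u * δ ≤ R) (hhalf : hsDiameter σ N + 2 * u * δ < 2⁻¹)
    {i : Fin (N + 1)} {s e : ℝ} (hse : s < e) (hes : e - s ≤ δ)
    (hie : Participates (Torus.geometry (Fin 3)) (hsDiameter σ N) (orbit σ N Φ z e) i)
    (his : Participates (Torus.geometry (Fin 3)) (hsDiameter σ N) (orbit σ N Φ z s) i)
    (hfree : ∀ t ∈ Ioo s e, ¬ Participates (Torus.geometry (Fin 3)) (hsDiameter σ N) (orbit σ N Φ z t) i)
    {q : Fin (N + 1)} (hq : q = partner (Torus.geometry (Fin 3)) (hsDiameter σ N) (orbit σ N Φ z e) i)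
    {b : ℝ} (hb : b = flightStart (Torus.geometry (Fin 3)) (hsDiameter σ N) (orbit σ N Φ z) s q e)
    (hslow_i : ‖(orbit σ N Φ z e i).2‖ ≤ u / 2) (hslow_q : ‖(orbit σ N Φ z e q).2‖ ≤ u / 2) :
    s ≤ b ∧ b < e ∧ (s < b → ¬ Participates (Torus.geometry (Fin 3)) (hsDiameter σ N) (orbit σ N Φ z b) i) ∧
    ∃ S T : Fin (N + 1), ((S = i ∧ T = q ∧ b = s) ∨ (S = q ∧ T = i ∧ s < b)) ∧
      Participates (Torus.geometry (Fin 3)) (hsDiameter σ N) (orbit σ N Φ z b) S ∧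
      ¬ Participates (Torus.geometry (Fin 3)) (hsDiameter σ N) (orbit σ N Φ z b) T ∧
      (T ≠ S ∧ T ≠ partner (Torus.geometry (Fin 3)) (hsDiameter σ N) (orbit σ N Φ z b) S ∧
        ‖sepAt (orbit σ N Φ z b) T S‖ ≤ R ∧ ‖(orbit σ N Φ z b T).2‖ ≤ u ∧
        (0 < ⟪sepAt (orbit σ N Φ z b) T S, relVel (orbit σ N Φ z b) S T⟫_ℝ ∧
          ‖sepAt (orbit σ N Φ z b) T S‖ ^ 2 * ‖relVel (orbit σ N Φ z b) S T‖ ^ 2 -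
              ⟪sepAt (orbit σ N Φ z b) T S, relVel (orbit σ N Φ z b) S T⟫_ℝ ^ 2 ≤
            (2 * hsDiameter σ N) ^ 2 * ‖relVel (orbit σ N Φ z b) S T‖ ^ 2)) ∧
      ‖sepAt (orbit σ N Φ z b) S i‖ ≤ R := by
  have hγ := isTraj hz
  have hδ : 0 < δ := lt_of_lt_of_le (sub_pos.2 hse) hes
  have hε2 : hsDiameter σ N < 2⁻¹ := by nlinarith [mul_pos hu hδ]
  have hG : (Torus.geometry (Fin 3)).IsHardSphereRegular (hsDiameter σ N) :=
    Torus.isHardSphereRegular_geometry hε2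
  -- the contact pairs at `e`
  have hiq : (i, q) ∈ contactPairs (Torus.geometry (Fin 3)) (hsDiameter σ N) (orbit σ N Φ z e) := by
    rcases collide_partner hie with h | h
    · rw [hq]; exact h
    · rw [hq]; exact (swap_mem_contactPairs_iff hG).1 h
  have hqi : (q, i) ∈ contactPairs (Torus.geometry (Fin 3)) (hsDiameter σ N) (orbit σ N Φ z e) :=
    (swap_mem_contactPairs_iff hG).2 hiq
  have hqne : q ≠ i := (mem_contactPairs.1 hqi).1
  -- the flight of `q` current at `e`
  have hfinq := hγ.finite_collisionTimesOf_inter_Ioo q s e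
  have hsb : s ≤ b := by rw [hb]; exact le_flightStart hfinq
  have hbe : b < e := by rw [hb]; exact flightStart_lt hfinq hse
  have hqf : ∀ t ∈ Ioo b e, ¬ Participates (Torus.geometry (Fin 3)) (hsDiameter σ N) (orbit σ N Φ z t) q := by
    intro t ht
    refine hγ.not_participates_of_mem_Ioo_flightStart (a := s) (t := e) ?_
    rw [← hb]; exact ht
  have hif : ∀ t ∈ Ioo b e, ¬ Participates (Torus.geometry (Fin 3)) (hsDiameter σ N) (orbit σ N Φ z t) i :=
    fun t ht => hfree t ⟨lt_of_le_of_lt hsb ht.1, ht.2⟩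
  -- energy: the pre-collisional velocities at `e` are `v_i(s)` and `v_q(b)`
  have hvi : (orbit σ N Φ z b i).2 = (orbit σ N Φ z s i).2 :=
    orbit_vel_eq_of_forall_not_participates hz i hfree ⟨hsb, hbe⟩
  have hpre := hγ.ofConfig_preVel_eq_leftLim hiq
  have hli : (Function.leftLim (orbit σ N Φ z) e i).2 = (orbit σ N Φ z s i).2 :=
    leftLim_orbit_vel_eq hz i hse hfree
  have hlq : (Function.leftLim (orbit σ N Φ z) e q).2 = (orbit σ N Φ z b q).2 :=
    leftLim_orbit_vel_eq hz q hbe hqf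
  have hE := HardSphereCollisionRecord.ofConfig_norm_sq_preVel (Torus.geometry (Fin 3)) (hsDiameter σ N)
    (orbit σ N Φ z e) e i q
  rw [hpre, hli, hlq] at hE
  simp only [HardSphereCollisionRecord.ofConfig_postVel] at hE
  obtain ⟨hui, huq⟩ := le_of_sq_add_sq_eq hu (norm_nonneg _) (norm_nonneg _) hE hslow_i hslow_q
  have huib : ‖(orbit σ N Φ z b i).2‖ ≤ u := by rw [hvi]; exact hui
  -- smallness of the pair free flight on `(b, e)`, both orders
  have hrv : ∀ S T : Fin (N + 1), ‖(orbit σ N Φ z b S).2‖ ≤ u → ‖(orbit σ N Φ z b T).2‖ ≤ u →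
      hsDiameter σ N + (e - b) * ‖relVel (orbit σ N Φ z b) T S‖ < 2⁻¹ ∧
      hsDiameter σ N + (e - b) * ‖relVel (orbit σ N Φ z b) T S‖ ≤ R := by
    intro S T hS hT
    have h1 : ‖relVel (orbit σ N Φ z b) T S‖ ≤ 2 * u := by
      unfold relVel
      calc ‖(orbit σ N Φ z b T).2 - (orbit σ N Φ z b S).2‖
          ≤ ‖(orbit σ N Φ z b T).2‖ + ‖(orbit σ N Φ z b S).2‖ := norm_sub_le _ _
        _ ≤ 2 * u := by linarith
    have h2 : (e - b) * ‖relVel (orbit σ N Φ z b) T S‖ ≤ δ * (2 * u) :=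
      mul_le_mul (by linarith) h1 (norm_nonneg _) hδ.le
    constructor <;> nlinarith
  rcases eq_or_lt_of_le hsb with hbs | hsb'
  · -- case `b = s`: shooter `i`, target `q`
    have hb_eq : b = s := hbs.symm
    rw [hb_eq] at hbe hqf huq huib hrv
    rw [hb_eq]
    -- `q` does not take part in the collision at `s`
    have hqs : ¬ Participates (Torus.geometry (Fin 3)) (hsDiameter σ N) (orbit σ N Φ z s) q := by
      intro hqs
      have hip : (i, partner (Torus.geometry (Fin 3)) (hsDiameter σ N) (orbit σ N Φ z s) i) ∈
          contactPairs (Torus.geometry (Fin 3)) (hsDiameter σ N) (orbit σ N Φ z s) := by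
        rcases collide_partner his with h | h
        · exact h
        · exact (swap_mem_contactPairs_iff hG).1 h
      rcases (hγ.participates_iff hip).1 hqs with h | h
      · exact hqne h
      · have hiqs : (i, q) ∈ contactPairs (Torus.geometry (Fin 3)) (hsDiameter σ N) (orbit σ N Φ z s) := by
          rw [h]; exact hip
        obtain ⟨hsm, -⟩ := hrv q i huq huib
        exact not_mem_contactPairs_of_contact_later hz hbe hfree hqf hsm hiq hiqs
    obtain ⟨hsm, hRle⟩ := hrv i q huib huq
    obtain ⟨hfar, hle, haim⟩ := slow_gap_geometry hz hε.le hbe hfree hqf hqs hqi hsm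
    refine ⟨le_rfl, hbe, fun h => absurd h (lt_irrefl _), i, q, Or.inl ⟨rfl, rfl, rfl⟩, his, hqs,
      ⟨hqne, ?_, hle.trans hRle, huq, haim⟩, ?_⟩
    · intro hqp
      have hpp : Participates (Torus.geometry (Fin 3)) (hsDiameter σ N) (orbit σ N Φ z s)
          (partner (Torus.geometry (Fin 3)) (hsDiameter σ N) (orbit σ N Φ z s) i) :=
        ⟨i, (collide_partner his).symm⟩
      rw [← hqp] at hpp
      exact hqs hpp
    · have h0 : ‖sepAt (orbit σ N Φ z s) i i‖ = 0 := by simp [sepAt]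
      rw [h0]
      linarith [norm_nonneg (relVel (orbit σ N Φ z s) q i), hle, hfar]
  · -- case `s < b`: shooter `q` (born at `b`), target `i` (mid-flight)
    have hbmem : b ∈ collisionTimesOf (Torus.geometry (Fin 3)) (hsDiameter σ N) (orbit σ N Φ z) q ∩ Ioo s e := by
      have hm := hγ.flightStart_mem s q e
      rw [← hb] at hm
      rcases mem_insert_iff.1 hm with h | h
      · exact absurd h (ne_of_gt hsb')
      · exact h
    have hqb : Participates (Torus.geometry (Fin 3)) (hsDiameter σ N) (orbit σ N Φ z b) q := hbmem.1
    have hib : ¬ Participates (Torus.geometry (Fin 3)) (hsDiameter σ N) (orbit σ N Φ z b) i :=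
      hfree b ⟨hsb', hbe⟩
    obtain ⟨hsm, hRle⟩ := hrv q i huq huib
    obtain ⟨-, hle, haim⟩ := slow_gap_geometry hz hε.le hbe hqf hif hib hiq hsm
    refine ⟨hsb, hbe, fun _ => hib, q, i, Or.inr ⟨rfl, rfl, hsb'⟩, hqb, hib,
      ⟨hqne.symm, ?_, hle.trans hRle, huib, haim⟩, ?_⟩
    · intro hip
      have hpp : Participates (Torus.geometry (Fin 3)) (hsDiameter σ N) (orbit σ N Φ z b)
          (partner (Torus.geometry (Fin 3)) (hsDiameter σ N) (orbit σ N Φ z b) q) :=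
        ⟨q, (collide_partner hqb).symm⟩
      rw [← hip] at hpp
      exact hib hpp
    · have hsymm : ‖sepAt (orbit σ N Φ z b) q i‖ = ‖sepAt (orbit σ N Φ z b) i q‖ :=
        Torus.euclidDist_comm _ _
      rw [hsymm]
      exact hle.trans hRle

/-! ## §4 Counting: the collision count of one sphere and the charging of its short gaps -/

/-- **The collision sum of `𝟙[fst = i]` is the number of collision times of `i`** in the window (binary
collisions in a regular geometry: at a collision time the two ordered contact pairs are `(p, q), (q, p)`, and exactly
one has first component `i` iff `i ∈ {p, q}`). [folklore] -/
theorem collisionSum_ite_fst_eq_card {d X : Type*} [Fintype d] [TopologicalSpace X] {G : Geometry d X}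
    {ε : ℝ} {n : ℕ} {γ : ℝ → Config n d X} (h : IsHardSphereTrajectory G ε n γ) (hG : G.IsHardSphereRegular ε)
    {S : Set ℝ} (hfin : (collisionTimes G ε γ ∩ S).Finite) (i : Fin n) :
    Literature.Analysis.FluidPDE.collisionSum G ε γ S (fun c => if c.fst = i then (1 : ℝ) else 0) =
      ((hfin.toFinset.filter fun t => Participates G ε (γ t) i).card : ℝ) := by
  rw [collisionSum_eq_finset_sum hfin, Finset.card_filter]
  push_cast
  refine Finset.sum_congr rfl fun t ht => ?_
  have ht' : t ∈ collisionTimes G ε γ := ((Set.Finite.mem_toFinset hfin).1 ht).1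
  obtain ⟨⟨p, q⟩, hp⟩ := mem_collisionTimes_iff_contactPairs_nonempty.1 ht'
  have hpq : p ≠ q := (mem_contactPairs.1 hp).1
  have hne : (p, q) ≠ (q, p) := fun hpe => hpq (Prod.mk.inj hpe).1
  rw [h.contactPairs_eq_pair hG hp, Finset.sum_pair hne]
  simp only [HardSphereCollisionRecord.ofConfig_fst]
  by_cases hi : Participates G ε (γ t) i
  · rw [if_pos hi]
    rcases (h.participates_iff hp).1 hi with rfl | rfl
    · rw [if_pos rfl, if_neg hpq.symm]; ring
    · rw [if_neg hpq, if_pos rfl]; ring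
  · rw [if_neg hi]
    have hp' : p ≠ i := fun h' => hi ((h.participates_iff hp).2 (Or.inl h'.symm))
    have hq' : q ≠ i := fun h' => hi ((h.participates_iff hp).2 (Or.inr h'.symm))
    rw [if_neg hp', if_neg hq']; ring

/-- **Own-birth charging of the short gaps.** Along a good orbit let `A` be a finite set of collision times `s` of
`i`, each followed by the next collision time `nx s ∈ (s, s + δ)` of `i`, `nx s ≤ w`, `i` flying freely on `(s, nx s)`,
with `nx s₁ ≤ s₂` whenever `s₁ < s₂` in `A`; let `ε + 2uδ ≤ R`, `ε + 2uδ < 1/2`. Let `gB ≥ 0` be a weight on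
(sphere, time) which is `1` at every collision `(k, t)` of `k` that is NORMAL (`Nrm k t`, any predicate) and at which
`k` is aimed (catch radius `R`, speed cap `u`, tolerance `2ε`) at some `j` with `i ∈ {k, j}`; let `gA ≥ 0` be a weight
on collision triples `(t, k, l)` which is `1` whenever `x_k(t)` is within `R` of `x_i(t)` and either the birth of `k`
at `t` is not normal or some sphere within `2R` of `x_i(t)` is faster than `u/2`. Then
`#A ≤ Σ_{k, t ∈ collision times ∩ (0, w+δ]} gB (k, t) + Σ_{collision triples of (0, w+δ]} gA`: by `slow_gap` each
gap is charged to the aimed normal birth `(shooter, b)`, or to the record `(b, (shooter, partner))` of an abnormal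
birth, `b ∈ [s, nx s)`, or — FAST end — to the record `(nx s, (q, i))`; charges of distinct gaps are distinct
(their times lie in the disjoint spans `[s, nx s]`, up to the common point `nx s₁ = s₂`, where a fast end charges
`(q, i)`, `q ≠ i`, and a birth of `i` charges `(i, ·)`). [folklore] -/
theorem card_shortGaps_le_sums (hz : z ∈ Φ.good) {u δ R w : ℝ} (hu : 0 < u) (hε : 0 < hsDiameter σ N)
    (hδ : 0 < δ) (hR : hsDiameter σ N + 2 * u * δ ≤ R) (hhalf : hsDiameter σ N + 2 * u * δ < 2⁻¹)
    (i : Fin (N + 1)) (Nrm : Fin (N + 1) → ℝ → Prop) (A : Finset ℝ) (nx : ℝ → ℝ)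
    (hA : ∀ s ∈ A, 0 < s ∧ s < nx s ∧ nx s ≤ w ∧ nx s - s < δ ∧
      Participates (Torus.geometry (Fin 3)) (hsDiameter σ N) (orbit σ N Φ z s) i ∧
      Participates (Torus.geometry (Fin 3)) (hsDiameter σ N) (orbit σ N Φ z (nx s)) i ∧
      ∀ t ∈ Ioo s (nx s), ¬ Participates (Torus.geometry (Fin 3)) (hsDiameter σ N) (orbit σ N Φ z t) i)
    (hsep : ∀ s₁ ∈ A, ∀ s₂ ∈ A, s₁ < s₂ → nx s₁ ≤ s₂)
    (hfin : (collisionTimes (Torus.geometry (Fin 3)) (hsDiameter σ N) (orbit σ N Φ z) ∩ Ioc 0 (w + δ)).Finite)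
    (gB : Fin (N + 1) × ℝ → ℝ) (gA : ℝ × Fin (N + 1) × Fin (N + 1) → ℝ)
    (hgB0 : ∀ x, 0 ≤ gB x) (hgA0 : ∀ x, 0 ≤ gA x)
    (hgB : ∀ (k : Fin (N + 1)) (t : ℝ) (j : Fin (N + 1)),
      Participates (Torus.geometry (Fin 3)) (hsDiameter σ N) (orbit σ N Φ z t) k → Nrm k t → (k = i ∨ j = i) →
      (j ≠ k ∧ j ≠ partner (Torus.geometry (Fin 3)) (hsDiameter σ N) (orbit σ N Φ z t) k ∧
        ‖sepAt (orbit σ N Φ z t) j k‖ ≤ R ∧ ‖(orbit σ N Φ z t j).2‖ ≤ u ∧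
        (0 < ⟪sepAt (orbit σ N Φ z t) j k, relVel (orbit σ N Φ z t) k j⟫_ℝ ∧
          ‖sepAt (orbit σ N Φ z t) j k‖ ^ 2 * ‖relVel (orbit σ N Φ z t) k j‖ ^ 2 -
              ⟪sepAt (orbit σ N Φ z t) j k, relVel (orbit σ N Φ z t) k j⟫_ℝ ^ 2 ≤
            (2 * hsDiameter σ N) ^ 2 * ‖relVel (orbit σ N Φ z t) k j‖ ^ 2)) →
      gB (k, t) = 1)
    (hgAfast : ∀ (t : ℝ) (k m : Fin (N + 1)), ‖sepAt (orbit σ N Φ z t) k i‖ ≤ R →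
      ‖sepAt (orbit σ N Φ z t) m i‖ ≤ 2 * R → u / 2 < ‖(orbit σ N Φ z t m).2‖ → gA (t, k, i) = 1)
    (hgAabn : ∀ (t : ℝ) (k l : Fin (N + 1)), ‖sepAt (orbit σ N Φ z t) k i‖ ≤ R → ¬ Nrm k t →
      gA (t, k, l) = 1) :
    (A.card : ℝ) ≤ (∑ x ∈ Finset.univ ×ˢ hfin.toFinset, gB x) +
      ∑ x ∈ (finite_collisionTriples hfin).toFinset, gA x := by
  have hγ := isTraj hz
  have hε2 : hsDiameter σ N < 2⁻¹ := by nlinarith [mul_pos hu hδ]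
  have hG : (Torus.geometry (Fin 3)).IsHardSphereRegular (hsDiameter σ N) :=
    Torus.isHardSphereRegular_geometry hε2
  have hRε : hsDiameter σ N ≤ R := by nlinarith [mul_pos hu hδ]
  -- per-gap data: partner at the end, birth of the relevant flight, the FAST predicate, shooter and target
  set q : ℝ → Fin (N + 1) := fun s => partner (Torus.geometry (Fin 3)) (hsDiameter σ N) (orbit σ N Φ z (nx s)) i
    with hqdef
  set b : ℝ → ℝ := fun s => flightStart (Torus.geometry (Fin 3)) (hsDiameter σ N) (orbit σ N Φ z) s (q s) (nx s)
    with hbdef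
  set Fast : ℝ → Prop := fun s =>
    u / 2 < ‖(orbit σ N Φ z (nx s) i).2‖ ∨ u / 2 < ‖(orbit σ N Φ z (nx s) (q s)).2‖ with hFastdef
  set Sh : ℝ → Fin (N + 1) := fun s => if b s = s then i else q s with hShdef
  set Tg : ℝ → Fin (N + 1) := fun s => if b s = s then q s else i with hTgdef
  -- the end of every gap: `(q s, i)` is a contact pair at `nx s`
  have hqi : ∀ s ∈ A, (q s, i) ∈ contactPairs (Torus.geometry (Fin 3)) (hsDiameter σ N) (orbit σ N Φ z (nx s)) ∧
      q s ≠ i := by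
    intro s hs
    obtain ⟨-, -, -, -, -, hie, -⟩ := hA s hs
    have h1 : (q s, i) ∈ contactPairs (Torus.geometry (Fin 3)) (hsDiameter σ N) (orbit σ N Φ z (nx s)) := by
      rcases collide_partner hie with h | h
      · exact (swap_mem_contactPairs_iff hG).2 h
      · exact h
    exact ⟨h1, (mem_contactPairs.1 h1).1⟩
  -- the slow gaps
  have hslow : ∀ s ∈ A, ¬ Fast s →
      s ≤ b s ∧ b s < nx s ∧
      (s < b s → ¬ Participates (Torus.geometry (Fin 3)) (hsDiameter σ N) (orbit σ N Φ z (b s)) i) ∧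
      Participates (Torus.geometry (Fin 3)) (hsDiameter σ N) (orbit σ N Φ z (b s)) (Sh s) ∧
      ¬ Participates (Torus.geometry (Fin 3)) (hsDiameter σ N) (orbit σ N Φ z (b s)) (Tg s) ∧
      (Tg s ≠ Sh s ∧ Tg s ≠ partner (Torus.geometry (Fin 3)) (hsDiameter σ N) (orbit σ N Φ z (b s)) (Sh s) ∧
        ‖sepAt (orbit σ N Φ z (b s)) (Tg s) (Sh s)‖ ≤ R ∧ ‖(orbit σ N Φ z (b s) (Tg s)).2‖ ≤ u ∧
        (0 < ⟪sepAt (orbit σ N Φ z (b s)) (Tg s) (Sh s), relVel (orbit σ N Φ z (b s)) (Sh s) (Tg s)⟫_ℝ ∧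
          ‖sepAt (orbit σ N Φ z (b s)) (Tg s) (Sh s)‖ ^ 2 * ‖relVel (orbit σ N Φ z (b s)) (Sh s) (Tg s)‖ ^ 2 -
              ⟪sepAt (orbit σ N Φ z (b s)) (Tg s) (Sh s), relVel (orbit σ N Φ z (b s)) (Sh s) (Tg s)⟫_ℝ ^ 2 ≤
            (2 * hsDiameter σ N) ^ 2 * ‖relVel (orbit σ N Φ z (b s)) (Sh s) (Tg s)‖ ^ 2)) ∧
      ‖sepAt (orbit σ N Φ z (b s)) (Sh s) i‖ ≤ R ∧ (Sh s = i ∨ Tg s = i) := by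
    intro s hs hnf
    obtain ⟨-, hlt, -, hgap, his, hie, hfree⟩ := hA s hs
    have hnf' : ‖(orbit σ N Φ z (nx s) i).2‖ ≤ u / 2 ∧ ‖(orbit σ N Φ z (nx s) (q s)).2‖ ≤ u / 2 := by
      simp only [hFastdef, not_or, not_lt] at hnf
      exact hnf
    obtain ⟨hsb, hbe, hmid, S, T, hST, hS, hT, haim, hdist⟩ :=
      slow_gap hz hu hε hR hhalf hlt (by linarith) hie his hfree (q := q s) rfl (b := b s) rfl hnf'.1 hnf'.2
    rcases hST with ⟨rfl, rfl, hbs⟩ | ⟨rfl, rfl, hsb'⟩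
    · have hSh : Sh s = S := if_pos hbs
      have hTg : Tg s = q s := if_pos hbs
      rw [hSh, hTg]
      exact ⟨hsb, hbe, hmid, hS, hT, haim, hdist, Or.inl rfl⟩
    · have hne : b s ≠ s := ne_of_gt hsb'
      have hSh : Sh s = q s := if_neg hne
      have hTg : Tg s = T := if_neg hne
      rw [hSh, hTg]
      exact ⟨hsb, hbe, hmid, hS, hT, haim, hdist, Or.inr rfl⟩
  -- windows
  have hnx_win : ∀ s ∈ A, nx s ∈ Set.Ioc 0 (w + δ) := by
    intro s hs
    obtain ⟨h0, hlt, hle, -⟩ := hA s hs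
    exact ⟨h0.trans hlt, by linarith⟩
  have hb_win : ∀ s ∈ A, ¬ Fast s → b s ∈ Set.Ioc 0 (w + δ) := by
    intro s hs hnf
    obtain ⟨h0, -, hle, -⟩ := hA s hs
    obtain ⟨hsb, hbe, -⟩ := hslow s hs hnf
    exact ⟨h0.trans_le hsb, by linarith⟩
  -- split `A` into the gaps charged to aimed normal births and the rest
  set An := A.filter fun s => ¬ Fast s ∧ Nrm (Sh s) (b s) with hAndef
  set Aa := A.filter fun s => ¬ (¬ Fast s ∧ Nrm (Sh s) (b s)) with hAadef
  have hsplit : A.card = An.card + Aa.card := (Finset.card_filter_add_card_filter_not _).symm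
  have hcardR : (A.card : ℝ) = (An.card : ℝ) + (Aa.card : ℝ) := by rw [hsplit]; push_cast; ring
  rw [hcardR]
  refine add_le_add ?_ ?_
  · -- aimed normal births, charge `s ↦ (shooter, b s)`
    refine card_le_sum_of_injOn An _ _ (fun s => (Sh s, b s)) (fun x _ => hgB0 x) (fun s hs => ?_) ?_
      (fun s hs => ?_)
    · rw [hAndef, Finset.mem_filter] at hs
      obtain ⟨hsA, hnf, -⟩ := hs
      obtain ⟨-, -, -, hS, -⟩ := hslow s hsA hnf
      rw [Finset.mem_product, Set.Finite.mem_toFinset]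
      exact ⟨Finset.mem_univ _, mem_collisionTimes_iff_exists_participates.2 ⟨_, hS⟩, hb_win s hsA hnf⟩
    · refine injOn_of_lt fun s₁ hs₁ s₂ hs₂ hlt heq => ?_
      rw [hAndef, Finset.mem_filter] at hs₁ hs₂
      have hb12 : b s₁ = b s₂ := (Prod.mk.inj heq).2
      obtain ⟨-, hbe₁, -⟩ := hslow s₁ hs₁.1 hs₁.2.1
      obtain ⟨hsb₂, -⟩ := hslow s₂ hs₂.1 hs₂.2.1
      have := hsep s₁ hs₁.1 s₂ hs₂.1 hlt
      linarith
    · rw [hAndef, Finset.mem_filter] at hs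
      obtain ⟨hsA, hnf, hnormal⟩ := hs
      obtain ⟨-, -, -, hS, -, haim, -, hpair⟩ := hslow s hsA hnf
      exact hgB (Sh s) (b s) (Tg s) hS hnormal hpair haim
  · -- abnormal records, charge `s ↦ (nx s, (q s, i))` (FAST) or `(b s, (shooter, partner))`
    refine card_le_sum_of_injOn Aa _ _
      (fun s => if Fast s then (nx s, (q s, i))
        else (b s, (Sh s, partner (Torus.geometry (Fin 3)) (hsDiameter σ N) (orbit σ N Φ z (b s)) (Sh s))))
      (fun x _ => hgA0 x) (fun s hs => ?_) ?_ (fun s hs => ?_)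
    · rw [hAadef, Finset.mem_filter] at hs
      obtain ⟨hsA, -⟩ := hs
      rw [Set.Finite.mem_toFinset, mem_collisionTriples]
      by_cases hf : Fast s
      · rw [if_pos hf]
        exact ⟨hnx_win s hsA, (hqi s hsA).1⟩
      · rw [if_neg hf]
        obtain ⟨-, -, -, hS, -⟩ := hslow s hsA hf
        refine ⟨hb_win s hsA hf, ?_⟩
        rcases collide_partner hS with h | h
        · exact h
        · exact (swap_mem_contactPairs_iff hG).1 h
    · refine injOn_of_lt fun s₁ hs₁ s₂ hs₂ hlt heq => ?_
      rw [hAadef, Finset.mem_filter] at hs₁ hs₂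
      have h12 := hsep s₁ hs₁.1 s₂ hs₂.1 hlt
      obtain ⟨-, hlt₂, -⟩ := hA s₂ hs₂.1
      by_cases hf₁ : Fast s₁
      · by_cases hf₂ : Fast s₂
        · rw [if_pos hf₁, if_pos hf₂] at heq
          have ht : nx s₁ = nx s₂ := (Prod.mk.inj heq).1
          linarith
        · rw [if_pos hf₁, if_neg hf₂] at heq
          obtain ⟨ht, hk⟩ := Prod.mk.inj heq
          have hk1 : q s₁ = Sh s₂ := (Prod.mk.inj hk).1
          obtain ⟨hsb₂, -, hmid₂, -⟩ := hslow s₂ hs₂.1 hf₂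
          by_cases hbs : b s₂ = s₂
          · have hSh : Sh s₂ = i := if_pos hbs
            exact (hqi s₁ hs₁.1).2 (hk1.trans hSh)
          · have hsb' : s₂ < b s₂ := lt_of_le_of_ne hsb₂ (Ne.symm hbs)
            obtain ⟨-, -, -, -, -, hie₁, -⟩ := hA s₁ hs₁.1
            rw [ht] at hie₁
            exact hmid₂ hsb' hie₁
      · obtain ⟨-, hbe₁, -⟩ := hslow s₁ hs₁.1 hf₁
        by_cases hf₂ : Fast s₂
        · rw [if_neg hf₁, if_pos hf₂] at heq
          have ht : b s₁ = nx s₂ := (Prod.mk.inj heq).1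
          linarith
        · rw [if_neg hf₁, if_neg hf₂] at heq
          have ht : b s₁ = b s₂ := (Prod.mk.inj heq).1
          obtain ⟨hsb₂, -⟩ := hslow s₂ hs₂.1 hf₂
          linarith
    · rw [hAadef, Finset.mem_filter] at hs
      obtain ⟨hsA, hnot⟩ := hs
      by_cases hf : Fast s
      · rw [if_pos hf]
        obtain ⟨hc, -⟩ := hqi s hsA
        have hdq : ‖sepAt (orbit σ N Φ z (nx s)) (q s) i‖ = hsDiameter σ N :=
          ((mem_contactPairs_iff_of_mem (orbit_mem hz (nx s))).1 hc).2
        have hdi : ‖sepAt (orbit σ N Φ z (nx s)) i i‖ = 0 := by simp [sepAt]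
        rcases hf with h | h
        · exact hgAfast (nx s) (q s) i (by rw [hdq]; exact hRε) (by rw [hdi]; linarith) h
        · exact hgAfast (nx s) (q s) (q s) (by rw [hdq]; exact hRε) (by rw [hdq]; linarith) h
      · rw [if_neg hf]
        have hnn : ¬ Nrm (Sh s) (b s) := fun h => hnot ⟨hf, h⟩
        obtain ⟨-, -, -, -, -, -, hdist, -⟩ := hslow s hsA hf
        exact hgAabn (b s) (Sh s) _ hdist hnn

end Orbit

end Literature.MathematicalPhysics.KineticTheory

end
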